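import Literature.AlgebraicGeometry.AbelianSchemes.TupleRelFacObjIso                         -- ★ `facObjIso` clauses, stage vocabulary, `isMonHom_facObjIso_hom`
import Literature.AlgebraicGeometry.AbelianSchemes.AbelianSchemeHomExtSchematicallyDominant   -- ★ `RingAction.rosati_of_baseChange`
import Literature.AlgebraicGeometry.AbelianSchemes.AbelianSchemeRosatiTransport              -- ★ `RingAction.rosati_of_transport`
import Literature.AlgebraicGeometry.AbelianSchemes.AbelianSchemeDualTransportUnique          -- ★ `eq_hatTransport_of_nonempty_pullback_map_iso`
import Literature.AlgebraicGeometry.Limits.LocalizationRelativeHomSpread                     -- ★ schematic dominance of the legs (`stage_hom_eq_of_generic_eq` imports)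
import HarnessLib

/-!
# ROSATI `ι(b̄) ≫ λ = λ ≫ ι(b)^∨` AT A FLAT STAGE from Rosati of the GENERIC tuple, through the `facObjIso` readings of the stage organs
# ([RapoportSmithlingZhang2020Diagonal] §3.2 ∕ Thm. 4.1; EGA IV₃ 11.10.5; [MilneAV2008] I §8 uniqueness of the dual)

Layer `Literature/AlgebraicGeometry/AbelianSchemes`, namespace `Literature.AlgebraicGeometry.AbelianSchemes.AbelianSchemeOver`.  THEOREMS ONLY
(no definition, no named fact, no instance, no notation, no `sorry`).  Cell `hodgecm-mathlib` (D-0151), P6 «MOD programme», crux hLiu418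
(`stmt-HodgeConjecture-24832`), P-LINE ED. 2 «GLOBAL SPREAD» leaf `Lines/F0_P6a_PELSpread.lean` (LEAD «M-55»), socket `stub_GSPREAD`, row **`rosati`**
of the stage tuple (squad «L4» DEAL v1 step (8a), seat LA4-p01 (g0); companion of ★ `QuasiInverseSpreadStage` = step (8b)).  Consumer one level down:
`PELSpreadAt.rosati : ∀ b b', (b' : F) = c b → act.i b' ≫ pol.lam = pol.lam ≫ DualPair.dualIsogenyOver (act.i b) dual dual` (v6f :137).  HC_CM is proved
only modulo the printed citations (2 remaining named inputs hLiu418 24832, h413 24833) until rung 0 closes; this file is generic, count-neutral, pays no letter.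

THE MATHEMATICS.  In the existence chain of `stub_GSPREAD` (B-p18 (g39) census `CENSUS-stubGSPREAD-chain.v1`) the ring action `ρₛ` and the polarisation
map `λₛ` of the stage tuple at `σ : s ⟶ t` are produced by ★ `exists_stage_ringAction` ∕ ★ `exists_stage_polarization_of_generic_polarization…` together
with their GENERIC READINGS through the identification `e := facObjIso (relLeg σ) 𝒜ₜ.X : (𝒜ₜ|ₛ)_K ≅ (𝒜ₜ)_K` (★ `OverFac.facObjIso`):
`(ρₛ.i a)_K ≫ e = e ≫ ρ.i a` and `(λₛ)_K ≫ Ĥ = e ≫ λ` for a dual comparison `Ĥ`.  Rosati is known for the generic tuple `((𝒜ₜ)_K, ρ, D, λ)` (E-line (S6-R),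
transported by ★ `RingAction.rosati_lamTransport`).  NO SPREADING (no shrinking of the stage) is needed to get it at the stage:
* §1 **`RingAction.rosati_of_transport_clauses`** ∕ **`…_iff_…`** — Rosati is invariant under an UNBUNDLED isomorphism of tuples `(e, Ĥ)` over one
  base: `e : A′ ≅ A` a group isomorphism, `Ĥ : Â′ → Â` ANY morphism carrying the Poincaré clause `(e × Ĥ)^*𝒫 ≅ 𝒫′` of [MumfordFogartyKirwan1994]
  Def. 7.3 along `𝟙 S` (the six-clause currency of ★ `TupleRelCancel` ∕ `TupleRelFacObjIso`), the `λ`-clause `λ′ ≫ Ĥ = e ≫ λ` and the `𝒪`-clause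
  `ι′(a) ≫ e = e ≫ ι(a)` on underlying schemes.  PROOF: `Ĥ` IS the dual transport `Ĥ_e` (★ `eq_hatTransport_of_nonempty_pullback_map_iso`, [MilneAV2008] I §8
  «unique»), then ★ `RingAction.rosati_of_transport` ([MumfordAV1970] §15 Thm. 1 functoriality of `f ↦ f^∨`).
* §2 **`RingAction.rosati_of_genOver`** — Rosati at the FLAT stage `P ⊗ D(s)` from Rosati of the base change along the cone leg `P ⊗ Spec K → P ⊗ D(s)`:
  ★ `RingAction.rosati_of_baseChange` (the leg is quasi-compact and scheme-theoretically dominant: ★ `quasiCompact_relLeg_left`, ★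
  `isSchemeTheoreticallyDominant_relLeg_left`, [EGAIV3] 11.10.5; [GortzWedhorn2020] Prop. 9.19).
* §3 **`RingAction.rosati_stage_of_generic`** — THE ROW: for `σ : s ⟶ t` (stage `s` flat), structures `(ρₛ, Dₛ, λₛ)` on `𝒜ₜ|ₛ` and `(ρ, D, λ)` on `(𝒜ₜ)_K`
  related through `e := facObjIso (relLeg σ) 𝒜ₜ.X` and a dual comparison `Ĥ` as above, Rosati for `((𝒜ₜ)_K, ρ, D, λ)` at `(b, b′)` implies Rosati for
  `(𝒜ₜ|ₛ, ρₛ, Dₛ, λₛ)` at `(b, b′)` (§1 on the base changes along the relative leg — ★ `RingAction.baseChange_i`, `DualPair.baseChange` — then §2).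
* §4 **`DualPair.hatTransport_facObjIso`** — for the RESTRICTED dual pair `Dₛ := Dₜ|ₛ` and `D := (Dₜ)_K` the canonical comparison `Ĥ := facObjIso (relLeg σ) Âₜ.X`
  carries the Poincaré clause (`DualPair.facObjIso_poincare`, the `X̂`∕Poincaré half of ★ `tupleRel_facObjIso_hom`, [GortzWedhorn2020] Prop. 4.16), hence IS
  the dual transport along `facObjIso (relLeg σ) 𝒜ₜ.X`; **`RingAction.rosati_stage_of_generic_facObjIso`** — §3 with the `λ`-clause VERBATIM in the output
  currency of ★ `exists_stage_polarization_of_generic_polarization_of_isUnit_two''` ∕ ★ `exists_stage_monHom`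
  (`(Over.pullback ℓ.left).map λₛ ≫ (facObjIso ℓ Âₜ.X).hom = (facObjIso ℓ 𝒜ₜ.X).hom ≫ λ`) and the `𝒪`-clause VERBATIM in that of ★ `exists_stage_ringAction`.

## References
* [RapoportSmithlingZhang2020Diagonal] M. Rapoport, B. Smithling, W. Zhang, *Arithmetic diagonal cycles on unitary Shimura varieties*, Compos. Math.
  156 (2020), §3.2 (the Rosati condition `ι(b̄) = λ⁻¹ ∘ ι(b)^∨ ∘ λ` of the PEL moduli problem), §4.1 Thm. 4.1 (p. 17).
* [Kottwitz1992] R. Kottwitz, *Points on some Shimura varieties over finite fields*, JAMS 5 (1992), §5 (pp. 389–391).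
* [MumfordFogartyKirwan1994] D. Mumford, J. Fogarty, F. Kirwan, *Geometric Invariant Theory*, 3rd ed. (1994), Ch. 7 §2 Def. 7.3 (p. 130), Ch. 6 §1
  Cor. 6.8 (p. 118).
* [MilneAV2008] J. S. Milne, *Abelian Varieties* (v2.00, 2008), I §8 pp. 36–37 (uniqueness of the dual pair).
* [MumfordAV1970] D. Mumford, *Abelian Varieties* (1970), §15 Thm. 1 (p. 143), §20 (pp. 189–190) (Rosati involution).
* [EGAIV3] A. Grothendieck, J. Dieudonné, *EGA IV₃* (1966), 11.10.5.  [GortzWedhorn2020] U. Görtz, T. Wedhorn, *Algebraic Geometry I*, 2nd ed. (2020),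
  Prop. 4.16 (p. 101), Section (4.7), Prop. 9.19 and Rem. 9.20, §(10.13).
* Tree: ★ `AbelianSchemeHomExtSchematicallyDominant` (`RingAction.rosati_of_baseChange`), ★ `AbelianSchemeRosatiTransport` (`RingAction.rosati_of_transport`,
  `DualPair.comp_eq_comp_dualIsogenyOver_iff_of_transport`), ★ `AbelianSchemeDualTransportUnique` (`eq_hatTransport_of_nonempty_pullback_map_iso`),
  ★ `TupleRelFacObjIso` (`baseChange_baseChange_hom_comp_of_fac`, `pullback_map_fst_fst_congr_base`), ★ `Limits/LocalizationRelativeGroupSpread`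
  (`genOver`, `stageOver`, `relLeg`, `quasiCompact_relLeg_left`, `isSchemeTheoreticallyDominant_relLeg_left`), ★ `AbelianSchemeOverSpreadStageStructure`
  (`isMonHom_facObjIso_hom`), ★ `AbelianSchemeFixedPowBaseChange` (`RingAction.baseChange`), ★ `AbelianSchemeDualPairBaseChange` (`DualPair.baseChange`).
-/

set_option autoImplicit false

noncomputable section

-- Mathlib's `Over`/pull-back API is stated across semireducible wrappers (as in the ★ `AbelianSchemes/*` files).
set_option backward.isDefEq.respectTransparency false

universe u

open CategoryTheory CategoryTheory.Limits AlgebraicGeometry MonoidalCategory CartesianMonoidalCategory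

namespace Literature.AlgebraicGeometry.AbelianSchemes

namespace AbelianSchemeOver

open Literature.AlgebraicGeometry.Limits Literature.AlgebraicGeometry.Limits.LocApprox
open Literature.AlgebraicGeometry.Limits.OverFac (facObjIso)
open Literature.AlgebraicGeometry.Limits (pullbackFacObjIso_hom_left_fst pullbackFacObjIso_naturality)
open Literature.AlgebraicGeometry.Motives (SchemeOver specOver)

/-! ## §1 Rosati is invariant under an unbundled isomorphism of tuples `(e, Ĥ)` along `𝟙 S` -/

section TransportClauses

variable {S : Scheme.{u}} {A A' : AbelianSchemeOver S} (e : A'.X ≅ A.X) [IsMonHom e.hom] (D : A.DualPair) (D' : A'.DualPair)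
  {O : Type*} [CommRing O] (act : A.RingAction O) (act' : A'.RingAction O)

/-- **ROSATI IS TRANSPORTED ALONG AN UNBUNDLED ISOMORPHISM OF TUPLES `(e, Ĥ)`** (six-clause currency): `e : A′ ≅ A` a group isomorphism over `S`,
`Ĥ : Â′ → Â` ANY morphism over `S` with the Poincaré clause `(e × Ĥ)^*𝒫 ≅ 𝒫′` along `𝟙 S`, the `λ`-clause `λ′ ≫ Ĥ = e ≫ λ` and the `𝒪`-clause
`ι′(a) ≫ e = e ≫ ι(a)` (underlying schemes).  Then `ι(b′) ≫ λ = λ ≫ ι(b)^∨` for `(A, act, D, λ)` gives the same for `(A′, act′, D′, λ′)`: `Ĥ = Ĥ_e` by the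
uniqueness of the dual ([MilneAV2008] I §8), and ★ `RingAction.rosati_of_transport`. [cite: MumfordFogartyKirwan1994, Ch. 7 §2 Definition 7.3 (p. 130)]
[cite: MilneAV2008, I §8 pp. 36–37] [cite: RapoportSmithlingZhang2020Diagonal, §3.2] -/
theorem RingAction.rosati_of_transport_clauses (Ĥ : D'.hat.X.left ⟶ D.hat.X.left)
    (wG : A'.X.hom ≫ 𝟙 S = e.hom.left ≫ A.X.hom) (wĜ : D'.hat.X.hom ≫ 𝟙 S = Ĥ ≫ D.hat.X.hom)
    (hP : Nonempty ((Scheme.Modules.pullback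
      (pullback.map A'.X.hom D'.hat.X.hom A.X.hom D.hat.X.hom e.hom.left Ĥ (𝟙 S) wG wĜ)).obj D.P ≅ D'.P))
    (lam : A.X ⟶ D.hat.X) (lam' : A'.X ⟶ D'.hat.X) (hlam : lam'.left ≫ Ĥ = e.hom.left ≫ lam.left)
    (hequiv : ∀ a, (act'.i a).left ≫ e.hom.left = e.hom.left ≫ (act.i a).left) (b b' : O)
    (h : haveI := act.isMonHom b
      act.i b' ≫ lam = lam ≫ DualPair.dualIsogenyOver (act.i b) D D) :
    haveI := act'.isMonHom b
    act'.i b' ≫ lam' = lam' ≫ DualPair.dualIsogenyOver (act'.i b) D' D' := by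
  have hĤ : Ĥ = DualPair.hatTransport D D' e := DualPair.eq_hatTransport_of_nonempty_pullback_map_iso D D' e Ĥ wG wĜ hP
  have hlam' : lam' ≫ DualPair.hatTransportOver D D' e = e.hom ≫ lam :=
    Over.OverMorphism.ext (by rw [Over.comp_left, Over.comp_left, DualPair.hatTransportOver_left, ← hĤ]; exact hlam)
  have hequiv' : ∀ a, act'.i a ≫ e.hom = e.hom ≫ act.i a := fun a =>
    Over.OverMorphism.ext (by rw [Over.comp_left, Over.comp_left]; exact hequiv a)
  exact RingAction.rosati_of_transport e D D' act act' hequiv' lam lam' hlam' b b' h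

/-- The same as an EQUIVALENCE (both directions; ★ `DualPair.comp_eq_comp_dualIsogenyOver_iff_of_transport`).
[cite: MumfordFogartyKirwan1994, Ch. 7 §2 Definition 7.3 (p. 130)] [cite: MilneAV2008, I §8 pp. 36–37] [cite: RapoportSmithlingZhang2020Diagonal, §3.2] -/
theorem RingAction.rosati_iff_of_transport_clauses (Ĥ : D'.hat.X.left ⟶ D.hat.X.left)
    (wG : A'.X.hom ≫ 𝟙 S = e.hom.left ≫ A.X.hom) (wĜ : D'.hat.X.hom ≫ 𝟙 S = Ĥ ≫ D.hat.X.hom)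
    (hP : Nonempty ((Scheme.Modules.pullback
      (pullback.map A'.X.hom D'.hat.X.hom A.X.hom D.hat.X.hom e.hom.left Ĥ (𝟙 S) wG wĜ)).obj D.P ≅ D'.P))
    (lam : A.X ⟶ D.hat.X) (lam' : A'.X ⟶ D'.hat.X) (hlam : lam'.left ≫ Ĥ = e.hom.left ≫ lam.left)
    (hequiv : ∀ a, (act'.i a).left ≫ e.hom.left = e.hom.left ≫ (act.i a).left) (b b' : O) :
    (haveI := act.isMonHom b; act.i b' ≫ lam = lam ≫ DualPair.dualIsogenyOver (act.i b) D D) ↔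
    (haveI := act'.isMonHom b; act'.i b' ≫ lam' = lam' ≫ DualPair.dualIsogenyOver (act'.i b) D' D') := by
  haveI := act.isMonHom b
  haveI := act'.isMonHom b
  have hĤ : Ĥ = DualPair.hatTransport D D' e := DualPair.eq_hatTransport_of_nonempty_pullback_map_iso D D' e Ĥ wG wĜ hP
  have hlam' : lam' ≫ DualPair.hatTransportOver D D' e = e.hom ≫ lam :=
    Over.OverMorphism.ext (by rw [Over.comp_left, Over.comp_left, DualPair.hatTransportOver_left, ← hĤ]; exact hlam)
  have hequiv' : ∀ a, act'.i a ≫ e.hom = e.hom ≫ act.i a := fun a =>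
    Over.OverMorphism.ext (by rw [Over.comp_left, Over.comp_left]; exact hequiv a)
  exact DualPair.comp_eq_comp_dualIsogenyOver_iff_of_transport e D D' lam lam' hlam' (act.i b') (act.i b) (act'.i b') (act'.i b)
    (hequiv' b') (hequiv' b)

end TransportClauses

/-! ## §2 Rosati at a flat stage from Rosati of the base change along the cone leg -/

section GenOver

variable {A : Type u} [CommRing A] [IsDomain A] (K : Type u) [Field K] [Algebra A K] [IsFractionRing A K]
  {P : SchemeOver A} {s : Idx (nonZeroDivisors A)} [Flat (pullback.snd P.hom ((baseDiagram (nonZeroDivisors A)).obj s).hom)]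
  {𝒜ₛ : AbelianSchemeOver (P ⊗ (baseDiagram (nonZeroDivisors A)).obj s).left} {O : Type*} [CommRing O]

/-- **ROSATI AT THE FLAT STAGE `P ⊗ D(s)` IS DETECTED ON THE BASE CHANGE ALONG THE CONE LEG `P ⊗ Spec K → P ⊗ D(s)`** (`A` a domain, `K = Frac A`):
the leg is quasi-compact and scheme-theoretically dominant (★ `quasiCompact_relLeg_left`, ★ `isSchemeTheoreticallyDominant_relLeg_left`), so ★
`RingAction.rosati_of_baseChange` applies — for ANY dual pair `D` and any `lam : 𝒜ₛ → D̂`. [cite: EGAIV3, 11.10.5] [cite: GortzWedhorn2020, Prop. 9.19 and Rem. 9.20]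
[cite: RapoportSmithlingZhang2020Diagonal, §3.2] -/
theorem RingAction.rosati_of_genOver (act : 𝒜ₛ.RingAction O) (D : 𝒜ₛ.DualPair) (lam : 𝒜ₛ.X ⟶ D.hat.X) (b b' : O)
    (h : haveI := (act.baseChange (genOver (nonZeroDivisors A) K P s).hom).isMonHom b
      (act.baseChange (genOver (nonZeroDivisors A) K P s).hom).i b' ≫ baseChangeHom lam (genOver (nonZeroDivisors A) K P s).hom =
        baseChangeHom lam (genOver (nonZeroDivisors A) K P s).hom ≫
          DualPair.dualIsogenyOver ((act.baseChange (genOver (nonZeroDivisors A) K P s).hom).i b)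
            (D.baseChange (genOver (nonZeroDivisors A) K P s).hom) (D.baseChange (genOver (nonZeroDivisors A) K P s).hom)) :
    haveI := act.isMonHom b
    act.i b' ≫ lam = lam ≫ DualPair.dualIsogenyOver (act.i b) D D := by
  haveI : IsSchemeTheoreticallyDominant (leg (nonZeroDivisors A) K s).left :=
    Literature.NumberTheory.EllipticCurves.isSchemeTheoreticallyDominant_leg_left K s
  haveI : QuasiCompact (genOver (nonZeroDivisors A) K P s).hom := quasiCompact_relLeg_left (nonZeroDivisors A) K P (𝟙 s)
  haveI : IsSchemeTheoreticallyDominant (genOver (nonZeroDivisors A) K P s).hom :=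
    isSchemeTheoreticallyDominant_relLeg_left (nonZeroDivisors A) K P (𝟙 s)
  exact RingAction.rosati_of_baseChange (genOver (nonZeroDivisors A) K P s).hom act D lam b b' h

end GenOver

/-! ## §3 THE ROW: Rosati for the stage tuple at `σ : s ⟶ t` from Rosati of the generic tuple, through the `facObjIso` readings -/

section Stage

variable {A : Type u} [CommRing A] [IsDomain A] (K : Type u) [Field K] [Algebra A K] [IsFractionRing A K]
  {P : SchemeOver A} {s t : Idx (nonZeroDivisors A)} (σ : s ⟶ t) [Flat (pullback.snd P.hom ((baseDiagram (nonZeroDivisors A)).obj s).hom)]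
  (𝒜ₜ : AbelianSchemeOver (P ⊗ (baseDiagram (nonZeroDivisors A)).obj t).left) {O : Type*} [CommRing O]
  -- the generic tuple on `(𝒜ₜ)_K`
  (ρ : RingAction O (𝒜ₜ.baseChange (genOver (nonZeroDivisors A) K P t).hom))
  (D : (𝒜ₜ.baseChange (genOver (nonZeroDivisors A) K P t).hom).DualPair)
  (lam : (𝒜ₜ.baseChange (genOver (nonZeroDivisors A) K P t).hom).X ⟶ D.hat.X)
  -- the stage tuple on `𝒜ₜ|ₛ`
  (ρₛ : RingAction O (𝒜ₜ.baseChange (stageOver (nonZeroDivisors A) P σ).hom))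
  (Dₛ : (𝒜ₜ.baseChange (stageOver (nonZeroDivisors A) P σ).hom).DualPair)
  (lamₛ : (𝒜ₜ.baseChange (stageOver (nonZeroDivisors A) P σ).hom).X ⟶ Dₛ.hat.X)

/-- **ROSATI FOR THE STAGE TUPLE FROM ROSATI OF THE GENERIC TUPLE** (row `rosati` of `stub_GSPREAD`).  Data: `σ : s ⟶ t` with `P ⊗ D(s)` flat; on
`(𝒜ₜ)_K` a ring action `ρ`, a dual pair `D`, `λ : (𝒜ₜ)_K → D̂`; on `𝒜ₜ|ₛ` a ring action `ρₛ`, a dual pair `Dₛ`, `λₛ : 𝒜ₜ|ₛ → D̂ₛ`; readings through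
`e := facObjIso (relLeg σ) 𝒜ₜ.X : (𝒜ₜ|ₛ)_K ≅ (𝒜ₜ)_K` — the `𝒪`-clause `(ρₛ.i a)_K ≫ e = e ≫ ρ.i a` (★ `exists_stage_ringAction` output) and, for a dual comparison
`Ĥ : (D̂ₛ)_K → D̂` over `P ⊗ Spec K` carrying the Poincaré clause along `𝟙`, the `λ`-clause `(λₛ)_K ≫ Ĥ = e ≫ λ`.  Then Rosati for `((𝒜ₜ)_K, ρ, D, λ)` at
`(b, b′)` implies Rosati for `(𝒜ₜ|ₛ, ρₛ, Dₛ, λₛ)` at `(b, b′)`: §1 on the base changes along the relative leg, then §2.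
[cite: RapoportSmithlingZhang2020Diagonal, §3.2 and §4.1 Thm. 4.1 (p. 17)] [cite: Kottwitz1992, §5 (pp. 389–391)] [cite: EGAIV3, 11.10.5] [cite: MilneAV2008, I §8 pp. 36–37] -/
theorem RingAction.rosati_stage_of_generic
    (hequiv : ∀ a, (Over.pullback (relLeg (nonZeroDivisors A) K P σ).left).map (ρₛ.i a) ≫ (facObjIso (relLeg (nonZeroDivisors A) K P σ) 𝒜ₜ.X).hom =
      (facObjIso (relLeg (nonZeroDivisors A) K P σ) 𝒜ₜ.X).hom ≫ ρ.i a)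
    (Ĥ : (Dₛ.baseChange (relLeg (nonZeroDivisors A) K P σ).left).hat.X.left ⟶ D.hat.X.left)
    (wG : ((𝒜ₜ.baseChange (stageOver (nonZeroDivisors A) P σ).hom).baseChange (relLeg (nonZeroDivisors A) K P σ).left).X.hom ≫
        𝟙 (genOver (nonZeroDivisors A) K P t).left =
      (facObjIso (relLeg (nonZeroDivisors A) K P σ) 𝒜ₜ.X).hom.left ≫ (𝒜ₜ.baseChange (genOver (nonZeroDivisors A) K P t).hom).X.hom)
    (wĜ : (Dₛ.baseChange (relLeg (nonZeroDivisors A) K P σ).left).hat.X.hom ≫ 𝟙 (genOver (nonZeroDivisors A) K P t).left = Ĥ ≫ D.hat.X.hom)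
    (hP : Nonempty ((Scheme.Modules.pullback
      (pullback.map ((𝒜ₜ.baseChange (stageOver (nonZeroDivisors A) P σ).hom).baseChange (relLeg (nonZeroDivisors A) K P σ).left).X.hom
        (Dₛ.baseChange (relLeg (nonZeroDivisors A) K P σ).left).hat.X.hom (𝒜ₜ.baseChange (genOver (nonZeroDivisors A) K P t).hom).X.hom D.hat.X.hom
        (facObjIso (relLeg (nonZeroDivisors A) K P σ) 𝒜ₜ.X).hom.left Ĥ (𝟙 _) wG wĜ)).obj D.P ≅
        (Dₛ.baseChange (relLeg (nonZeroDivisors A) K P σ).left).P))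
    (hlam : (baseChangeHom lamₛ (relLeg (nonZeroDivisors A) K P σ).left).left ≫ Ĥ =
      (facObjIso (relLeg (nonZeroDivisors A) K P σ) 𝒜ₜ.X).hom.left ≫ lam.left)
    (b b' : O)
    (h : haveI := ρ.isMonHom b
      ρ.i b' ≫ lam = lam ≫ DualPair.dualIsogenyOver (ρ.i b) D D) :
    haveI := ρₛ.isMonHom b
    ρₛ.i b' ≫ lamₛ = lamₛ ≫ DualPair.dualIsogenyOver (ρₛ.i b) Dₛ Dₛ := by
  let ℓ := relLeg (nonZeroDivisors A) K P σ
  -- the identification `(𝒜ₜ|ₛ)_K ≅ (𝒜ₜ)_K`, typed in the `baseChange` spelling (group structures found structurally)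
  let e : ((𝒜ₜ.baseChange (stageOver (nonZeroDivisors A) P σ).hom).baseChange ℓ.left).X ≅
      (𝒜ₜ.baseChange (genOver (nonZeroDivisors A) K P t).hom).X := facObjIso ℓ 𝒜ₜ.X
  haveI : IsMonHom e.hom := isMonHom_facObjIso_hom ℓ 𝒜ₜ.X
  -- (1) Rosati for the base change of the stage tuple along the relative leg, transported from the generic tuple (§1)
  have hequiv' : ∀ a, ((ρₛ.baseChange ℓ.left).i a).left ≫ e.hom.left = e.hom.left ≫ (ρ.i a).left := fun a => by
    have ha := congrArg CommaMorphism.left (hequiv a)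
    simp only [Over.comp_left] at ha
    exact ha
  have h₁ := RingAction.rosati_of_transport_clauses e D (Dₛ.baseChange ℓ.left) ρ (ρₛ.baseChange ℓ.left) Ĥ wG wĜ hP lam
    (baseChangeHom lamₛ ℓ.left) hlam hequiv' b b' h
  -- (2) the relative leg is quasi-compact and scheme-theoretically dominant into the flat stage (§2)
  haveI : IsSchemeTheoreticallyDominant (leg (nonZeroDivisors A) K s).left :=
    Literature.NumberTheory.EllipticCurves.isSchemeTheoreticallyDominant_leg_left K s
  haveI : QuasiCompact ℓ.left := quasiCompact_relLeg_left (nonZeroDivisors A) K P σ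
  haveI : IsSchemeTheoreticallyDominant ℓ.left := isSchemeTheoreticallyDominant_relLeg_left (nonZeroDivisors A) K P σ
  exact RingAction.rosati_of_baseChange ℓ.left ρₛ Dₛ lamₛ b b' h₁

end Stage

/-! ## §4 The restricted dual pair: `facObjIso (relLeg σ) Âₜ.X` carries the Poincaré clause and IS the dual transport -/

section FacObjIso

variable {X : Scheme.{u}} {T G : Over X} (ℓ : G ⟶ T) (𝒜 : AbelianSchemeOver X) (D : 𝒜.DualPair)

/-- The comparison `(𝒜 ×_X T) ×_T G ≅ 𝒜 ×_X G` lies over `𝟙 G` (the `wG`∕`wĜ` book-keeping of the six-clause currency).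
[cite: GortzWedhorn2020, Prop. 4.16 (p. 101)] -/
theorem facObjIso_hom_w_id :
    ((𝒜.baseChange T.hom).baseChange ℓ.left).X.hom ≫ 𝟙 G.left = (facObjIso ℓ 𝒜.X).hom.left ≫ (𝒜.baseChange G.hom).X.hom := by
  rw [Category.comp_id]
  exact (Over.w (facObjIso ℓ 𝒜.X).hom).symm

/-- **THE POINCARÉ CLAUSE OF `(facObjIso ℓ 𝒜.X, facObjIso ℓ Â.X)`**: `(e × ê)^* 𝒫_G ≅ (𝒫_T)_ℓ` for the restricted dual pairs `(D ×_X T) ×_T G` and `D ×_X G`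
— both Poincaré sheaves are pull-backs of `𝒫` along maps to `𝒜 ×_X Â` agreeing after `facObjIso` (the `X̂`∕Poincaré half of ★ `tupleRel_facObjIso_hom`, same
proof; no polarisation or level structure needed). [cite: MumfordFogartyKirwan1994, Ch. 7 §2 Definition 7.3 (p. 130)] [cite: GortzWedhorn2020, Prop. 4.16 (p. 101)] -/
theorem DualPair.facObjIso_poincare :
    Nonempty ((Scheme.Modules.pullback
      (pullback.map ((𝒜.baseChange T.hom).baseChange ℓ.left).X.hom ((D.baseChange T.hom).baseChange ℓ.left).hat.X.hom
        (𝒜.baseChange G.hom).X.hom (D.baseChange G.hom).hat.X.hom (facObjIso ℓ 𝒜.X).hom.left (facObjIso ℓ D.hat.X).hom.left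
        (𝟙 G.left) (facObjIso_hom_w_id ℓ 𝒜) (facObjIso_hom_w_id ℓ D.hat))).obj (D.baseChange G.hom).P ≅
        ((D.baseChange T.hom).baseChange ℓ.left).P) := by
  -- both sheaves are pull-backs of `𝒫` (★ canonical clauses), and the maps to `𝒜 ×_X Â` agree after `facObjIso`
  have wAb : (𝒜.baseChange G.hom).X.hom ≫ G.hom = pullback.fst 𝒜.X.hom G.hom ≫ 𝒜.X.hom := pullback.condition.symm
  have wHb : (D.baseChange G.hom).hat.X.hom ≫ G.hom = pullback.fst D.hat.X.hom G.hom ≫ D.hat.X.hom := pullback.condition.symm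
  obtain ⟨eb⟩ := D.nonempty_pullback_map_P_iso_baseChange_P G.hom wAb wHb
  -- the iterated Poincaré clause, RE-READ along `G.hom` (`ℓ ≫ T.hom = G.hom`; `pullback.map` does not depend on the base map)
  obtain ⟨e₂⟩ := DualPair.nonempty_pullback_map_P_iso_baseChange_baseChange_P 𝒜 D T.hom ℓ.left
  have e₂' : (Scheme.Modules.pullback (pullback.map ((𝒜.baseChange T.hom).baseChange ℓ.left).X.hom
      ((D.baseChange T.hom).baseChange ℓ.left).hat.X.hom 𝒜.X.hom D.hat.X.hom
      (pullback.fst (pullback.snd 𝒜.X.hom T.hom) ℓ.left ≫ pullback.fst 𝒜.X.hom T.hom)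
      (pullback.fst (pullback.snd D.hat.X.hom T.hom) ℓ.left ≫ pullback.fst D.hat.X.hom T.hom) G.hom
      (baseChange_baseChange_hom_comp_of_fac ℓ 𝒜) (baseChange_baseChange_hom_comp_of_fac ℓ D.hat))).obj D.P ≅
      ((D.baseChange T.hom).baseChange ℓ.left).P :=
    (Scheme.Modules.pullbackCongr (pullback_map_fst_fst_congr_base ℓ 𝒜 D)).app D.P ≪≫ e₂
  exact DualPair.nonempty_pullback_map_iso_of_comp_eq D (D.baseChange G.hom) ((D.baseChange T.hom).baseChange ℓ.left)
    wAb wHb (baseChange_baseChange_hom_comp_of_fac ℓ 𝒜) (baseChange_baseChange_hom_comp_of_fac ℓ D.hat) eb e₂'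
    (pullbackFacObjIso_hom_left_fst T.hom ℓ.left G.hom (Over.w ℓ) 𝒜.X)
    (pullbackFacObjIso_hom_left_fst T.hom ℓ.left G.hom (Over.w ℓ) D.hat.X) (facObjIso_hom_w_id ℓ 𝒜) (facObjIso_hom_w_id ℓ D.hat)

/-- **THE DUAL TRANSPORT ALONG `facObjIso ℓ 𝒜.X` IS `facObjIso ℓ Â.X`** (uniqueness of the dual, [MilneAV2008] I §8, through ★
`eq_hatTransport_of_nonempty_pullback_map_iso` and the Poincaré clause above). [cite: MilneAV2008, I §8 pp. 36–37] [cite: GortzWedhorn2020, Prop. 4.16 (p. 101)] -/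
theorem DualPair.facObjIso_hat_eq_hatTransport :
    haveI : IsMonHom (M := ((𝒜.baseChange T.hom).baseChange ℓ.left).X) (N := (𝒜.baseChange G.hom).X) (facObjIso ℓ 𝒜.X).hom :=
      isMonHom_facObjIso_hom ℓ 𝒜.X
    (facObjIso ℓ D.hat.X).hom.left = DualPair.hatTransport (D.baseChange G.hom) ((D.baseChange T.hom).baseChange ℓ.left) (facObjIso ℓ 𝒜.X) :=
  haveI : IsMonHom (M := ((𝒜.baseChange T.hom).baseChange ℓ.left).X) (N := (𝒜.baseChange G.hom).X) (facObjIso ℓ 𝒜.X).hom :=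
    isMonHom_facObjIso_hom ℓ 𝒜.X
  DualPair.eq_hatTransport_of_nonempty_pullback_map_iso (D.baseChange G.hom) ((D.baseChange T.hom).baseChange ℓ.left) (facObjIso ℓ 𝒜.X)
    (facObjIso ℓ D.hat.X).hom.left (facObjIso_hom_w_id ℓ 𝒜) (facObjIso_hom_w_id ℓ D.hat) (DualPair.facObjIso_poincare ℓ 𝒜 D)

end FacObjIso

section StageFacObjIso

variable {A : Type u} [CommRing A] [IsDomain A] (K : Type u) [Field K] [Algebra A K] [IsFractionRing A K]
  {P : SchemeOver A} {s t : Idx (nonZeroDivisors A)} (σ : s ⟶ t) [Flat (pullback.snd P.hom ((baseDiagram (nonZeroDivisors A)).obj s).hom)]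
  (𝒜ₜ : AbelianSchemeOver (P ⊗ (baseDiagram (nonZeroDivisors A)).obj t).left) (Dₜ : 𝒜ₜ.DualPair) {O : Type*} [CommRing O]
  (ρ : RingAction O (𝒜ₜ.baseChange (genOver (nonZeroDivisors A) K P t).hom))
  (lam : (𝒜ₜ.baseChange (genOver (nonZeroDivisors A) K P t).hom).X ⟶ (Dₜ.baseChange (genOver (nonZeroDivisors A) K P t).hom).hat.X)
  (ρₛ : RingAction O (𝒜ₜ.baseChange (stageOver (nonZeroDivisors A) P σ).hom))
  (lamₛ : (𝒜ₜ.baseChange (stageOver (nonZeroDivisors A) P σ).hom).X ⟶ (Dₜ.baseChange (stageOver (nonZeroDivisors A) P σ).hom).hat.X)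

/-- **ROSATI FOR THE STAGE TUPLE `(𝒜ₜ|ₛ, ρₛ, Dₜ|ₛ, λₛ)` FROM ROSATI OF THE GENERIC TUPLE `((𝒜ₜ)_K, ρ, (Dₜ)_K, λ)` — TURNKEY FORM** for the RESTRICTED dual
pairs of one dual pair `Dₜ` of `𝒜ₜ` (e.g. the letter՚s `dualPairOf hDUALS 𝒜ₜ`), with the readings VERBATIM in the output currency of ★ `exists_stage_ringAction`
(`(ρₛ.i a)|_K ≫ e_𝒜 = e_𝒜 ≫ ρ.i a`) and ★ `exists_stage_monHom` ∕ ★ `exists_stage_polarization_of_generic_polarization…` (`λₛ|_K ≫ e_Â = e_𝒜 ≫ λ`), `e_Q := facObjIso (relLeg σ) Q`: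
§3 with `Ĥ := e_Â`, whose Poincaré clause is §4. [cite: RapoportSmithlingZhang2020Diagonal, §3.2 and §4.1 Thm. 4.1 (p. 17)] [cite: Kottwitz1992, §5 (pp. 389–391)]
[cite: EGAIV3, 11.10.5] [cite: MilneAV2008, I §8 pp. 36–37] -/
theorem RingAction.rosati_stage_of_generic_facObjIso
    (hequiv : ∀ a, (Over.pullback (relLeg (nonZeroDivisors A) K P σ).left).map (ρₛ.i a) ≫ (facObjIso (relLeg (nonZeroDivisors A) K P σ) 𝒜ₜ.X).hom =
      (facObjIso (relLeg (nonZeroDivisors A) K P σ) 𝒜ₜ.X).hom ≫ ρ.i a)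
    (hlam : (Over.pullback (relLeg (nonZeroDivisors A) K P σ).left).map lamₛ ≫ (facObjIso (relLeg (nonZeroDivisors A) K P σ) Dₜ.hat.X).hom =
      (facObjIso (relLeg (nonZeroDivisors A) K P σ) 𝒜ₜ.X).hom ≫ lam)
    (b b' : O)
    (h : haveI := ρ.isMonHom b
      ρ.i b' ≫ lam = lam ≫ DualPair.dualIsogenyOver (ρ.i b) (Dₜ.baseChange (genOver (nonZeroDivisors A) K P t).hom)
        (Dₜ.baseChange (genOver (nonZeroDivisors A) K P t).hom)) :
    haveI := ρₛ.isMonHom b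
    ρₛ.i b' ≫ lamₛ = lamₛ ≫ DualPair.dualIsogenyOver (ρₛ.i b) (Dₜ.baseChange (stageOver (nonZeroDivisors A) P σ).hom)
      (Dₜ.baseChange (stageOver (nonZeroDivisors A) P σ).hom) := by
  have hlam' : (baseChangeHom lamₛ (relLeg (nonZeroDivisors A) K P σ).left).left ≫ (facObjIso (relLeg (nonZeroDivisors A) K P σ) Dₜ.hat.X).hom.left =
      (facObjIso (relLeg (nonZeroDivisors A) K P σ) 𝒜ₜ.X).hom.left ≫ lam.left := by
    have hl := congrArg CommaMorphism.left hlam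
    simp only [Over.comp_left] at hl
    exact hl
  exact RingAction.rosati_stage_of_generic K σ 𝒜ₜ ρ (Dₜ.baseChange (genOver (nonZeroDivisors A) K P t).hom) lam ρₛ
    (Dₜ.baseChange (stageOver (nonZeroDivisors A) P σ).hom) lamₛ hequiv (facObjIso (relLeg (nonZeroDivisors A) K P σ) Dₜ.hat.X).hom.left
    (facObjIso_hom_w_id (relLeg (nonZeroDivisors A) K P σ) 𝒜ₜ) (facObjIso_hom_w_id (relLeg (nonZeroDivisors A) K P σ) Dₜ.hat)
    (DualPair.facObjIso_poincare (relLeg (nonZeroDivisors A) K P σ) 𝒜ₜ Dₜ) hlam' b b' h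

end StageFacObjIso

/-! ## §5 (ED. 2) Rosati is PRESERVED by base change — the localisation of the row to `𝓜.localise w` -/

section BaseChangeForward

variable {S T : Scheme.{u}} (f : T ⟶ S) {A : AbelianSchemeOver S} {O : Type*} [CommRing O]

/-- **`(α ≫ λ = λ ≫ β^∨) ×_S T`** (atomic form): a Rosati-type identity restricts along ANY base change `f : T → S`, the dual being formed with the
base-changed dual pair (`(β^∨)_T = (β_T)^∨`, ★ `baseChangeHom_dualIsogenyOver`; functoriality of `(–) ×_S T`).  The converse for `f` quasi-compact
scheme-theoretically dominant is ★ `comp_eq_comp_dualIsogenyOver_of_baseChange`. [cite: MumfordFogartyKirwan1994, Ch. 6 §1 Cor. 6.8 (p. 118)]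
[cite: GortzWedhorn2020, Section (4.7)] [cite: RapoportSmithlingZhang2020Diagonal, §3.2] -/
theorem comp_eq_comp_dualIsogenyOver_baseChange (D : A.DualPair) (lam : A.X ⟶ D.hat.X) (α β : A.X ⟶ A.X) [IsMonHom β]
    (h : α ≫ lam = lam ≫ DualPair.dualIsogenyOver β D D) :
    baseChangeHom α f ≫ baseChangeHom lam f =
      baseChangeHom lam f ≫ @DualPair.dualIsogenyOver T (A.baseChange f) (A.baseChange f) (baseChangeHom β f)
        (isMonHom_baseChangeHom β f) (D.baseChange f) (D.baseChange f) := by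
  rw [← baseChangeHom_dualIsogenyOver f β D D]
  change (Over.pullback f).map α ≫ (Over.pullback f).map lam = (Over.pullback f).map lam ≫ (Over.pullback f).map _
  rw [← Functor.map_comp, ← Functor.map_comp, h]

/-- **ROSATI IS PRESERVED BY BASE CHANGE** (`RGDInputsAt.rosati` ∕ `PELSpreadAt.rosati` shape): `ι(b′) ≫ λ = λ ≫ ι(b)^∨` for `(A, act, D, λ)` over `S` gives
`ι_T(b′) ≫ λ_T = λ_T ≫ ι_T(b)^∨` for `(A_T, act ×_S T, D ×_S T, λ_T)` over `T` (★ `RingAction.baseChange_i`).  In the `stub_GSPREAD` chain: Rosati at the stage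
`P ⊗ D(s)` (§3∕§4) ⇒ Rosati for the localised tuple over `(𝓜.localise w).total = P ⊗ Spec 𝒪_(w)` along `P ◁ τ_w` (★ `PELTupleStageLocalise`).
[cite: RapoportSmithlingZhang2020Diagonal, §3.2 and §4.1 Thm. 4.1 (p. 17)] [cite: Kottwitz1992, §5 (pp. 389–391)] [cite: MumfordFogartyKirwan1994, Ch. 6 §1 Cor. 6.8 (p. 118)] -/
theorem RingAction.rosati_baseChange (act : A.RingAction O) (D : A.DualPair) (lam : A.X ⟶ D.hat.X) (b b' : O)
    (h : haveI := act.isMonHom b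
      act.i b' ≫ lam = lam ≫ DualPair.dualIsogenyOver (act.i b) D D) :
    haveI := (act.baseChange f).isMonHom b
    (act.baseChange f).i b' ≫ baseChangeHom lam f =
      baseChangeHom lam f ≫ DualPair.dualIsogenyOver ((act.baseChange f).i b) (D.baseChange f) (D.baseChange f) := by
  haveI := act.isMonHom b
  exact comp_eq_comp_dualIsogenyOver_baseChange f D lam (act.i b') (act.i b) h

/-- **The whole row under base change**: the `PELSpreadAt.rosati` clause `∀ b b', r b b' → ι(b′) ≫ λ = λ ≫ ι(b)^∨` (any side condition `r`, e.g.
`(b' : F) = c b`) is stable under `(–) ×_S T`. [cite: RapoportSmithlingZhang2020Diagonal, §3.2 and §4.1 Thm. 4.1 (p. 17)] [cite: Kottwitz1992, §5 (pp. 389–391)] -/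
theorem RingAction.rosati_row_baseChange (act : A.RingAction O) (D : A.DualPair) (lam : A.X ⟶ D.hat.X) (r : O → O → Prop)
    (h : ∀ b b' : O, r b b' →
      haveI := act.isMonHom b
      act.i b' ≫ lam = lam ≫ DualPair.dualIsogenyOver (act.i b) D D) :
    ∀ b b' : O, r b b' →
      haveI := (act.baseChange f).isMonHom b
      (act.baseChange f).i b' ≫ baseChangeHom lam f =
        baseChangeHom lam f ≫ DualPair.dualIsogenyOver ((act.baseChange f).i b) (D.baseChange f) (D.baseChange f) :=
  fun b b' hr => RingAction.rosati_baseChange f act D lam b b' (h b b' hr)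

end BaseChangeForward

end AbelianSchemeOver

end Literature.AlgebraicGeometry.AbelianSchemes

end
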